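import Summits.BirchSwinnertonDyer.BirchSwinnertonDyer.Theses.PAdicOrderV2
import Summits.BirchSwinnertonDyer.BirchSwinnertonDyer.Theses.SelmerRank
import Summits.BirchSwinnertonDyer.BirchSwinnertonDyer.Theorems.PAdicOrderV2PAdicOrderComparisonR2StubConstantCoeff
import Summits.BirchSwinnertonDyer.BirchSwinnertonDyer.Theorems.PAdicOrderV2PAdicOrderComparisonR2StubTwoLeOrder
import Summits.BirchSwinnertonDyer.BirchSwinnertonDyer.Theorems.PAdicOrderV2PAdicOrderComparisonR2StubKerMulTRatSqEq
import Summits.BirchSwinnertonDyer.BirchSwinnertonDyer.Theorems.PAdicOrderV2PAdicOrderComparisonR2StubOrderEqSelmerCorank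
import Literature.NumberTheory.EllipticCurves.PAdicBSD
import Literature.NumberTheory.EllipticCurves.SelmerCorankControl
import Literature.NumberTheory.EllipticCurves.KatoRankBoundSelmerProofs
import Literature.NumberTheory.EllipticCurves.IwasawaSelmerDualProofs
import Literature.NumberTheory.EllipticCurves.SelmerInftyTorsionFiniteProofs

/-!
# Crux #2 `PAdicOrderComparisonR2` at `p ≥ 5` from the route items and Mazur control
# (line `Sketch`, skeleton v9, lead c3 — helper file, `--supports stmt-BirchSwinnertonDyer-0489`)

Two sorry-free by-products of skeleton v9 of line `Sketch`
(`Cruxes/PAdicOrderComparisonR2/Lines/Sketch.lean`), which takes the cyclotomic main conjecture as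
the ROUTE ITEM crux #7 `PAdicOrderMainConjectureR7` (stmt-BirchSwinnertonDyer-15426) instead of the
v8 stubs MC-print / MC-res:

* `selmerCorank_le_order_of_mainConjectureR7` — Kato's Selmer-corank bound (the v8 stub K, until now
  XL literature debt on `kato_divisibility`) at every odd good ordinary prime is a CONSEQUENCE of the
  item: the equality `char_Λ X = (g)`, `ι g = p^k L_p` in `Λ ⊗ ℚ_p` contains Kato's divisibility, and
  `corank Sel_{p^∞}(E/ℚ) ≤ rank_{ℤ_p} X/TX ≤ ord_T g ≤ ord_T ι g = ord_T L_p` by the tree theorems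
  `WeierstrassCurve.selmerCorank_le_coinvariantsRank` (easy half of control) and
  `IwasawaAlgebra.coinvariantsRank_le_order_of_mem_charIdeal` (structure theory); the same argument
  gives the route's support item `PAdicOrderKatoSideR2` (stmt-0491, `rank E(ℚ) ≤ ord_T L_p`) from the
  item (`padicOrderKatoSideR2_of_mainConjectureR7`, with the Kummer identity
  `corank Sel = rank + corank Ш[p^∞]`, tree theorem `selmerCorank_eq_mordellWeilRank_add_holds`);
* `pAdicOrderComparisonR2_five_le_of_items` — the `5 ≤ p` SLICE of crux #2 (the only part the thesis
  `PAdicOrderThesisR2`, `∃` one good ordinary `p ≥ 5`, consumes) follows from the six route items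
  crux #5 `PAdicOrderRankOneR4` (0515), `SelmerRankLB`/`SelmerRankUB`/`SelmerRankSmallImage`
  (0131/0130/14418), crux #4 `PAdicOrderSemisimpleR3` (0509), crux #7 `PAdicOrderMainConjectureR7`
  (15426) and ONE named Literature fact, Mazur's control theorem in corank form
  `Greenberg1999_coinvariantsRank_eq_selmerCorank_rat` (Greenberg LNM 1716 Thm 1.2; in-tree
  discharge reduced to Greenberg's Lemma 3.4 at `n = 0`). No stub of the line enters: the two
  remaining open stubs SEL3 (`p = 3`) and RES2 (`p = 2`) live outside this slice.

References: K. Kato, Astérisque 295 (2004), Thm 17.4, 18.4; R. Greenberg, LNM 1716 (1999), Thm 1.2,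
§1 p. 65, §4; B. Mazur, J. Tate, J. Teitelbaum, Invent. Math. 84 (1986), §II.10.
-/

-- the problem directory `BirchSwinnertonDyer/BirchSwinnertonDyer` forces the duplicated namespace segment
set_option linter.dupNamespace false

namespace Summit.BirchSwinnertonDyer.BirchSwinnertonDyer.Theorems

open Summit.BirchSwinnertonDyer.BirchSwinnertonDyer.Theses.PAdicOrderV2
open Summit.BirchSwinnertonDyer.BirchSwinnertonDyer.Theses.SelmerRank (SelmerRankLB SelmerRankUB
  SelmerRankSmallImage)
open Literature.NumberTheory.EllipticCurves

/-- **Kato's Selmer-corank bound from the main conjecture in `Λ ⊗ ℚ_p` (pointwise).** On a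
cyclotomic datum `(κ, γ, D)` for `E/ℚ` (globally minimal `W`) with `X = D.X` torsion over `Λ`, if
`char_Λ X = (g)` and `ι g = p^k · L` in `ℚ_p⟦T⟧` (`k ∈ ℤ`), then
`corank_{ℤ_p} Sel_{p^∞}(E/ℚ) ≤ ord_{T=0} L`: `corank Sel ≤ rank_{ℤ_p} X/TX`
(`WeierstrassCurve.selmerCorank_le_coinvariantsRank`, the proved easy half of Mazur control; `X` is
finitely generated over `Λ` over the cyclotomic tower, `SelmerDualData.module_finite_of_isCyclotomic`)
`≤ ord_T g` (`IwasawaAlgebra.coinvariantsRank_le_order_of_mem_charIdeal`, structure theory)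
`≤ ord_T ι g = ord_T (p^k L) = ord_T L`. This is Kato's step Thm 17.4 ⇒ Thm 18.4 with the
divisibility replaced by the (stronger) equality of the main conjecture.
[cite: Kato2004Asterisque, Thm 18.4 (p. 281)] -/
theorem selmerCorank_le_order_of_charIdeal_eq
    (W : WeierstrassCurve ℚ) [W.IsElliptic] [W.IsGloballyMinimal] (p : ℕ) [Fact p.Prime]
    {κ : ZpExtension ℚ p} {γ : Field.absoluteGaloisGroup ℚ} (hκ : κ.IsCyclotomic)
    (hγ : κ.IsTopGenerator γ) (D : W.SelmerDualData κ γ) (htors : D.IsTorsion)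
    {g : IwasawaAlgebra p} {k : ℤ} {L : PowerSeries ℚ_[p]} (hg : D.charIdeal = Ideal.span {g})
    (hι : iwasawaToPowerSeries p g = PowerSeries.C ((p : ℚ_[p]) ^ k) * L) :
    (W.selmerCorank p : ℕ∞) ≤ L.order := by
  haveI : Module.Finite (IwasawaAlgebra p) D.X := D.module_finite_of_isCyclotomic W κ hκ hγ
  -- `corank Sel ≤ rank X/TX ≤ ord g`
  have h0 : (W.selmerCorank p : ℕ∞) ≤ (IwasawaAlgebra.coinvariantsRank p D.X : ℕ∞) := by
    exact_mod_cast W.selmerCorank_le_coinvariantsRank hγ D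
  have hgmem : g ∈ D.charIdeal := by
    rw [hg]
    exact Ideal.mem_span_singleton_self g
  have h1 : (W.selmerCorank p : ℕ∞) ≤ PowerSeries.order g :=
    h0.trans (IwasawaAlgebra.coinvariantsRank_le_order_of_mem_charIdeal D.X htors g hgmem)
  -- `ord g ≤ ord (ι g)` (coefficientwise `ℤ_p → ℚ_p`)
  have h2 : PowerSeries.order g ≤ PowerSeries.order (iwasawaToPowerSeries p g) :=
    PowerSeries.le_order_map _
  -- `ord (ι g) = ord (p^k L) = ord L`
  have hpk : IsUnit (PowerSeries.C ((p : ℚ_[p]) ^ k)) := by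
    refine IsUnit.map PowerSeries.C (IsUnit.mk0 _ (zpow_ne_zero k ?_))
    exact_mod_cast (Fact.out : p.Prime).ne_zero
  have h3 : PowerSeries.order (iwasawaToPowerSeries p g) = L.order := by
    rw [hι, PowerSeries.order_mul, PowerSeries.order_zero_of_unit hpk, zero_add]
  exact h3 ▸ h1.trans h2

/-- **Kato's Selmer-corank bound (the v8 stub K of line `Sketch`, verbatim) from the route item
`PAdicOrderMainConjectureR7`** (stmt-BirchSwinnertonDyer-15426): at an odd good ordinary prime `p`
and for the newform `f` of `E`, `corank_{ℤ_p} Sel_{p^∞}(E/ℚ) ≤ ord_{T=0} L_p(f, α_p, T)`. The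
cyclotomic datum exists by the tree theorems
`exists_isCyclotomic_isTopGenerator_isCyclotomicVariable_holds` and
`WeierstrassCurve.nonempty_selmerDualData_holds`; then `selmerCorank_le_order_of_charIdeal_eq`.
Neither `kato_divisibility` nor a Skinner–Urban fact is used: the item carries them.
[cite: Kato2004Asterisque, Thm 18.4 (p. 281)] -/
theorem selmerCorank_le_order_of_mainConjectureR7 :
    Summit.BirchSwinnertonDyer.BirchSwinnertonDyer.Theses.PAdicOrderV2.PAdicOrderMainConjectureR7 →
    ∀ (W : WeierstrassCurve ℚ) [W.IsElliptic] [W.IsGloballyMinimal] (p : ℕ) [Fact p.Prime],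
      p ≠ 2 → Literature.NumberTheory.EllipticCurves.IsOrdinaryAt W p →
      ∀ {N : ℕ} [NeZero N] (f : CuspForm (CongruenceSubgroup.Gamma0 N) 2),
        Literature.NumberTheory.EllipticCurves.ModularForms.IsNewformOf W f →
          (W.selmerCorank p : ℕ∞) ≤
            (Literature.NumberTheory.EllipticCurves.padicLFunction f
              (Literature.NumberTheory.EllipticCurves.unitRoot W p : ℚ_[p])).order := by
  intro hMC W _ _ p _ hp2 hord N _ f hf
  have hp3 : 3 ≤ p := by
    have := (Fact.out : p.Prime).two_le
    omega
  obtain ⟨κ, hκ, γ, hγ, hγ'⟩ := exists_isCyclotomic_isTopGenerator_isCyclotomicVariable_holds p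
  obtain ⟨D⟩ := W.nonempty_selmerDualData_holds κ γ hγ
  obtain ⟨htors, g, k, hg, hι⟩ := hMC W p hp3 hord.1 hord.2 κ γ hκ hγ hγ' f hf D
  exact selmerCorank_le_order_of_charIdeal_eq W p hκ hγ D htors hg hι

/-- **The route's support item `PAdicOrderKatoSideR2` (stmt-BirchSwinnertonDyer-0491, Kato's
height-free inequality `rank_ℤ E(ℚ) ≤ ord_{T=0} L_p(f, α_p, T)` at every odd good ordinary `p`)
from the main-conjecture item `PAdicOrderMainConjectureR7`**: `rank E(ℚ) ≤ corank Sel_{p^∞}(E/ℚ)`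
(Kummer: `corank Sel = rank + corank Ш[p^∞]`, tree theorem
`WeierstrassCurve.selmerCorank_eq_mordellWeilRank_add_holds`) `≤ ord_T L_p`
(`selmerCorank_le_order_of_mainConjectureR7`). Kato, Thm 18.4, "In particular".
[cite: Kato2004Asterisque, Thm 18.4 (p. 281)] -/
theorem padicOrderKatoSideR2_of_mainConjectureR7 (hMC : PAdicOrderMainConjectureR7) :
    PAdicOrderKatoSideR2 := by
  intro W _ _ p _ hp2 hord N _ f hf
  refine le_trans ?_ (selmerCorank_le_order_of_mainConjectureR7 hMC W p hp2 hord f hf)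
  have h : W.selmerCorank p = W.mordellWeilRank + W.shaCorank p :=
    W.selmerCorank_eq_mordellWeilRank_add_holds p
  exact_mod_cast h ▸ Nat.le_add_right _ _

/-- **Crux #2 at every good ordinary prime `p ≥ 5`, from the six route items and Mazur's control
theorem alone.** For `E/ℚ` (globally minimal `W`), `p ≥ 5` good ordinary and the newform `f` of `E`:
`ord_{T=0} L_p(f, α_p, T) = ord_{s=1} L(E,s)` in `ℕ∞`, assuming the route items crux #5
`PAdicOrderRankOneR4` (rank one), route SelmerRank's `SelmerRankLB`/`SelmerRankUB`/`SelmerRankSmallImage`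
(`corank Sel_{p^∞} = r_an` at `p ≥ 5`), crux #4 `PAdicOrderSemisimpleR3` (semisimplicity at `T`),
crux #7 `PAdicOrderMainConjectureR7` (IMC in `Λ ⊗ ℚ_p`) and the named tree fact
`Greenberg1999_coinvariantsRank_eq_selmerCorank_rat` (Mazur control in corank form, Greenberg LNM 1716
Thm 1.2). Cases: `r_an = 0` by interpolation (`stub_constantCoeff_eq_zero_iff`: `L_p(E,0) ≠ 0`);
`r_an = 1` is crux #5; `r_an ≥ 2`: `≤` is `ord_T L_p = ord_T g = rank X/TX = corank Sel = r_an` (item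
MC, semisimplicity through the landed SS-bridge `stub_ker_mulTRat_sq_eq`, control, the landed
bookkeeping `stub_order_eq_selmerCorank`, Selmer side), `≥` is parity in rank 2
(`stub_two_le_order_of_analyticRank_eq_two`) and `r_an = corank Sel ≤ ord_T L_p`
(`selmerCorank_le_order_of_mainConjectureR7`) in rank `≥ 3`. The stubs SEL3 (`p = 3`) and RES2
(`p = 2`) of the line do not enter this slice. [cite: MazurTateTeitelbaum1986Invent, §II.10]
[cite: GreenbergLNM1716, Thm. 1.2 and §1 p. 65] -/
theorem pAdicOrderComparisonR2_five_le_of_items :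
    Summit.BirchSwinnertonDyer.BirchSwinnertonDyer.Theses.PAdicOrderV2.PAdicOrderRankOneR4 →
    Summit.BirchSwinnertonDyer.BirchSwinnertonDyer.Theses.SelmerRank.SelmerRankLB →
    Summit.BirchSwinnertonDyer.BirchSwinnertonDyer.Theses.SelmerRank.SelmerRankUB →
    Summit.BirchSwinnertonDyer.BirchSwinnertonDyer.Theses.SelmerRank.SelmerRankSmallImage →
    Summit.BirchSwinnertonDyer.BirchSwinnertonDyer.Theses.PAdicOrderV2.PAdicOrderSemisimpleR3 →
    Summit.BirchSwinnertonDyer.BirchSwinnertonDyer.Theses.PAdicOrderV2.PAdicOrderMainConjectureR7 →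
    Literature.NumberTheory.EllipticCurves.Greenberg1999_coinvariantsRank_eq_selmerCorank_rat →
    ∀ (W : WeierstrassCurve ℚ) [W.IsElliptic] [W.IsGloballyMinimal] (p : ℕ) [Fact p.Prime],
      5 ≤ p → Literature.NumberTheory.EllipticCurves.IsOrdinaryAt W p →
      ∀ {N : ℕ} [NeZero N] (f : CuspForm (CongruenceSubgroup.Gamma0 N) 2),
        Literature.NumberTheory.EllipticCurves.ModularForms.IsNewformOf W f →
          (Literature.NumberTheory.EllipticCurves.padicLFunction f
            (Literature.NumberTheory.EllipticCurves.unitRoot W p : ℚ_[p])).order = W.analyticRank := by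
  intro h5 hLB hUB hSI hSS hMC hCT W _ _ p _ hp5 hord N _ f hf
  have hp2 : p ≠ 2 := by omega
  have hp3 : 3 ≤ p := by omega
  have h1 := stub_constantCoeff_eq_zero_iff W p hord f hf
  -- the Selmer side at `p ≥ 5`, `r_an ≥ 2`
  have hsel : 2 ≤ W.analyticRank → W.selmerCorank p = W.analyticRank := fun _ => by
    by_cases hs : W.HasSurjectiveModNGaloisRep p
    · exact le_antisymm (hUB W p hp5 hord.1 hord.2 hs) (hLB W p hp5 hord.1 hord.2 hs)
    · exact hSI W p hp5 hord.1 hord.2 hs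
  rcases Nat.lt_or_ge W.analyticRank 1 with h0 | hpos
  · -- analytic rank 0: the constant term is a unit of ℚ_p, so the T-order is 0
    have hr : W.analyticRank = 0 := by omega
    have hc : PowerSeries.constantCoeff (Literature.NumberTheory.EllipticCurves.padicLFunction f
        (Literature.NumberTheory.EllipticCurves.unitRoot W p : ℚ_[p])) ≠ 0 := by
      intro h
      have := h1.mp h
      omega
    rw [hr, Nat.cast_zero]
    refine PowerSeries.order_eq_nat.mpr ⟨?_, fun i hi => (Nat.not_lt_zero i hi).elim⟩
    simpa only [PowerSeries.coeff_zero_eq_constantCoeff] using hc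
  · rcases Nat.lt_or_ge W.analyticRank 2 with hlt2 | h2
    · -- analytic rank 1: crux #5
      have hr : W.analyticRank = 1 := by omega
      rw [hr, Nat.cast_one]
      exact h5 W p hord hr f hf
    · apply le_antisymm
      · -- upper bound: MC item, SS item + SS-bridge, control fact, BK
        obtain ⟨κ, hκ, γ, hγ, hγ'⟩ := exists_isCyclotomic_isTopGenerator_isCyclotomicVariable_holds p
        obtain ⟨D⟩ := W.nonempty_selmerDualData_holds κ γ hγ
        obtain ⟨htors, hmc⟩ := hMC W p hp3 hord.1 hord.2 κ γ hκ hγ hγ' f hf D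
        have hss := stub_ker_mulTRat_sq_eq p D.X (hSS W p hp2 hord.1 hord.2 κ γ hκ hγ D)
        have hctrl := (hCT W p hord.1 hord.2 κ γ hκ hγ D).2
        have hoc := stub_order_eq_selmerCorank W p κ γ hκ hγ f D htors hmc hss hctrl
        rw [hoc, hsel h2]
      · -- lower bound: parity in rank 2, K-from-item in rank ≥ 3
        rcases Nat.lt_or_ge W.analyticRank 3 with hlt3 | _
        · have hr : W.analyticRank = 2 := by omega
          rw [hr, Nat.cast_ofNat]
          exact stub_two_le_order_of_analyticRank_eq_two W p hord f hf hr
        · rw [← hsel h2]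
          exact selmerCorank_le_order_of_mainConjectureR7 hMC W p hp2 hord f hf

end Summit.BirchSwinnertonDyer.BirchSwinnertonDyer.Theorems
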